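import Mathlib
import HarnessLib
import Literature.MathematicalPhysics.StatisticalMechanics.LinearisedMapLargePartNorm
import Literature.MathematicalPhysics.StatisticalMechanics.FluctuationOfHamiltonian
import Literature.MathematicalPhysics.StatisticalMechanics.RelevantProjectionTranslation
import Literature.MathematicalPhysics.StatisticalMechanics.ReblockingNeighbourhoods

/-!
# The linearised renormalisation map `C^{(q)}` ([ABKM19] (6.58), (10.1)–(10.5)) and the assembly of
# its bound (Lemma 10.1) from the single-block and large-polymer estimates

[ABKM19] Theorem 6.8: the derivative of `T_k` at `(H, K) = (0, 0)` is triangular with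
`D_K K_{k+1} = C^{(q)}`,
`(C^{(q)} K)(U, φ) = Σ_{B ∈ ℬ_k, B̄ = U} (1 − Π₂) R_{k+1} K(B, φ) + Σ_{X ∈ 𝒫_k^c∖ℬ_k, π(X)=U} R_{k+1}K(X, φ)`
((6.58)); Ch. 10.1 writes this as `G(U) + F(U)` ((10.1)–(10.5)).  Here, for the concrete step data
`D : StepData` of `RenormalisationMap` (so `R_{k+1} = fluct D.𝒞` and `Π₂` is read off at the
reference block, `Π₂ R_{k+1} K = −opB D K` as a coefficient vector, cf. `nextH_eq`):

* `blockTerm D K B φ = R K(B)(φ) − (Π₂ R K)(B, φ)` (`G(B)`, (10.4)), `blockPart D K U` (`G(U)`,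
  (10.3), (10.5)), **`opC D K U φ = blockPart + largePart`** ((6.58) = (10.1));
* `closure_blockOf_mul`, `blockPartIndex_subset_blocks`, `eq_blockOf_of_mem_blockPartIndex` — the
  index set `{B ∈ ℬ_k : B̄ = U}` is empty unless `U` is a `(k+1)`-block, and then it is `ℬ_k(U)`
  (`L^d` blocks);
* `fluct_translate`, `apply_eq_of_transInv`, **`blockTerm_eq_Pi2Rem`** — for translation-invariant
  `K` every block term IS a `Π₂`-remainder with its own base point:
  `blockTerm D K B = Pi2Rem (c₀ + v) B (R K(B))` for `B = B₀ + v` (`Pi2_translate`), and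
  `exists_blockOf_eq_translate` — every `k`-block is a lattice translate of the reference block;
* **`tayNormLE_blockPart`** — per-block bounds `|G(B)|_{T_φ} ≤ C c_G A^{−1} w(φ)` give
  `|G(U)|_{T_φ} ≤ C (L^d c_G) A^{−|U|_{k+1}} w(φ)` (the summation step of Lemma 10.4, (10.13));
* **`tayNormLE_opC`** — Lemma 10.1 assembled: with the hypotheses of `tayNormLE_largePart`
  (Lemma 10.2) in addition, `|(C^{(q)}K)(U)|_{T_φ} ≤ C (L^d c_G + ε(A)) A^{−|U|_{k+1}} w(φ)`;
  [ABKM19] chooses `L` then `A` so that `L^d c_G ≤ ½θ` (Lemma 10.4) and `ε(A) ≤ ¼θ` (Lemma 10.2).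

The per-block constant `c_G` (Lemma 10.3: `C'(C_1 L^{−d'} + 8(C_2+1)L^{−3d/2})`) and the
per-polymer integration bounds are hypotheses here; everything stated is proved.

## References
* S. Adams, S. Buchholz, R. Kotecký, S. Müller, arXiv:1910.13564, Theorem 6.8 (6.58), Ch. 10.1
  (10.1)–(10.5), Lemmas 10.1–10.4 [AdamsBuchholzKoteckyMuller2019].
-/

noncomputable section

namespace Literature.MathematicalPhysics.StatisticalMechanics.GradientRG

open scoped BigOperators Classical
open Finset
open Literature.MathematicalPhysics.StatisticalMechanics.TorusPolymer
  (IsPolymer blocks polys closure reblock blockOf thicken mem_blocks mem_blockOf mem_closure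
    blockOf_eq_of_mem mem_blockOf_self isPolymer_blockOf closure_subset_of_isPolymer
    blockOf_subset_blockOf_mul subset_closure blocks_blockOf card_blocks_blockOf_mul)
open Literature.Barriers.CriticalPhenomena.LongRangePhi4.Polymer (IsConn)
open Literature.MathematicalPhysics.QuantumFieldTheory

variable {d M : ℕ} [NeZero M]

/-! ## Definitions -/

/-- **`G(B)(φ) = (1 − Π₂) R_{k+1} K(B, φ)`** ((10.4)): the fluctuation integral of the one-block
activity minus its relevant part; the coefficient vector `Π₂R_{k+1}K = −opB D K` is read off at the
reference block `D.B₀` and evaluated on `B` (translation invariance of `K`).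
[cite: AdamsBuchholzKoteckyMuller2019, Ch. 10.1 (10.4)] -/
def blockTerm (D : StepData d M) (K : Finset (Fin d → ZMod M) → ((Fin d → ZMod M) → ℝ) → ℂ)
    (B : Finset (Fin d → ZMod M)) (φ : (Fin d → ZMod M) → ℝ) : ℂ :=
  fluct D.𝒞 (K B) φ + eval (opB D K) B φ

/-- The index set of `G(U)`: the `k`-blocks `B` with `B̄ = U`. [cite: AdamsBuchholzKoteckyMuller2019, Ch. 10.1 (10.3)] -/
def blockPartIndex (D : StepData d M) (U : Finset (Fin d → ZMod M)) : Finset (Finset (Fin d → ZMod M)) :=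
  (blocks D.s univ).filter fun B => closure (D.L * D.s) B = U

/-- **`G(U)(φ) = Σ_{B ∈ ℬ_k, B̄ = U} G(B)(φ)`** ((10.3); zero unless `U ∈ ℬ_{k+1}`, (10.5)).
[cite: AdamsBuchholzKoteckyMuller2019, Ch. 10.1 (10.3), (10.5)] -/
def blockPart (D : StepData d M) (K : Finset (Fin d → ZMod M) → ((Fin d → ZMod M) → ℝ) → ℂ)
    (U : Finset (Fin d → ZMod M)) (φ : (Fin d → ZMod M) → ℝ) : ℂ :=
  ∑ B ∈ blockPartIndex D U, blockTerm D K B φ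

/-- **The linearised map `(C^{(q)} K)(U, φ) = G(U)(φ) + F(U)(φ)`** ((6.58) = (10.1)).
[cite: AdamsBuchholzKoteckyMuller2019, Theorem 6.8 (6.58)] -/
def opC (D : StepData d M) (K : Finset (Fin d → ZMod M) → ((Fin d → ZMod M) → ℝ) → ℂ)
    (U : Finset (Fin d → ZMod M)) (φ : (Fin d → ZMod M) → ℝ) : ℂ :=
  blockPart D K U φ + largePart D.s D.L (fluct D.𝒞) K U φ

/-! ## The index set of `G(U)` -/

/-- The `(k+1)`-closure of a `k`-block is the `(k+1)`-block containing it (odd sides).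
[cite: AdamsBuchholzKoteckyMuller2019, Ch. 6.2] -/
theorem closure_blockOf_mul {s L : ℕ} (hs : Odd s) (hL : Odd L) (x : Fin d → ZMod M) :
    closure (L * s) (blockOf s x) = blockOf (L * s) x := by
  apply Subset.antisymm
  · exact closure_subset_of_isPolymer (blockOf_subset_blockOf_mul hs hL x) (isPolymer_blockOf _ x)
  · intro y hy
    exact mem_closure.2 ⟨x, mem_blockOf_self s x, mem_blockOf.1 hy⟩

/-- Every `B` with `B̄ = U` is a `k`-block inside `U`. [cite: AdamsBuchholzKoteckyMuller2019, Ch. 10.1 (10.3)] -/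
theorem blockPartIndex_subset_blocks (D : StepData d M) (U : Finset (Fin d → ZMod M)) :
    blockPartIndex D U ⊆ blocks D.s U := by
  intro B hB
  obtain ⟨hB, hcl⟩ := mem_filter.1 hB
  obtain ⟨x, -, rfl⟩ := mem_blocks.1 hB
  refine mem_blocks.2 ⟨x, ?_, rfl⟩
  rw [← hcl]
  exact subset_closure _ _ (mem_blockOf_self D.s x)

/-- If some `k`-block has `B̄ = U` then `U` is a single `(k+1)`-block ((10.5)).
[cite: AdamsBuchholzKoteckyMuller2019, Ch. 10.1 (10.5)] -/
theorem eq_blockOf_of_mem_blockPartIndex (D : StepData d M) (hs : Odd D.s) (hL : Odd D.L)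
    {U B : Finset (Fin d → ZMod M)} (hB : B ∈ blockPartIndex D U) :
    ∃ x : Fin d → ZMod M, U = blockOf (D.L * D.s) x := by
  obtain ⟨hB, hcl⟩ := mem_filter.1 hB
  obtain ⟨x, -, rfl⟩ := mem_blocks.1 hB
  exact ⟨x, by rw [← hcl, closure_blockOf_mul hs hL x]⟩

/-- The index set of `G(U)` has at most `L^d` elements, and is empty unless `|U|_{k+1} = 1`.
[cite: AdamsBuchholzKoteckyMuller2019, proof of Lemma 10.4] -/
theorem card_blockPartIndex_le (D : StepData d M) {t : ℕ} (hM : M = D.L * D.s * t) (hs : Odd D.s)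
    (hL : Odd D.L) (ht : Odd t) (U : Finset (Fin d → ZMod M)) :
    (blockPartIndex D U).card ≤ D.L ^ d ∧
      (blockPartIndex D U ≠ ∅ → (blocks (D.L * D.s) U).card = 1) := by
  by_cases he : blockPartIndex D U = ∅
  · simp [he]
  obtain ⟨B, hB⟩ := nonempty_iff_ne_empty.2 he
  obtain ⟨x, rfl⟩ := eq_blockOf_of_mem_blockPartIndex D hs hL hB
  refine ⟨(card_le_card (blockPartIndex_subset_blocks D _)).trans
    (card_blocks_blockOf_mul hM hs hL ht x).le, fun _ => ?_⟩
  rw [blocks_blockOf, card_singleton]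

/-! ## Every block term is a `Π₂`-remainder (translation invariance) -/

/-- The fluctuation integral commutes with translations: `R(F ∘ τ_{−a}) = (RF) ∘ τ_{−a}` (the step
measure is translation invariant). [cite: AdamsBuchholzKoteckyMuller2019, Lemma 6.4 (1)] -/
theorem fluct_translate {𝒞 : (Fin d → ZMod M) → ℝ} (hC : (Matrix.circulant 𝒞).PosSemidef)
    (F : ((Fin d → ZMod M) → ℝ) → ℂ) (a : Fin d → ZMod M) (φ : (Fin d → ZMod M) → ℝ) :
    fluct 𝒞 (fun ψ => F (fieldShift (-a) ψ)) φ = fluct 𝒞 F (fieldShift (-a) φ) := by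
  unfold fluct
  simp_rw [fieldShift_add]
  exact integral_fieldShift_eq (map_fieldShift_stepMeasure hC (-a)) fun ξ => F (fieldShift (-a) φ + ξ)

omit [NeZero M] in
/-- A translation-invariant `K` on a translated polymer is `K` composed with the inverse shift:
`K(X + a, ψ) = K(X, τ_{−a}ψ)`. [cite: AdamsBuchholzKoteckyMuller2019, Lemma 6.4 (1)] -/
theorem apply_eq_of_transInv {s : ℕ} {K : Finset (Fin d → ZMod M) → ((Fin d → ZMod M) → ℝ) → ℂ}
    (hK : TransInv s K) {a : Fin d → ZMod M} (ha : TorusPolymer.IsLatticeVec s a)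
    (X : Finset (Fin d → ZMod M)) (ψ : (Fin d → ZMod M) → ℝ) :
    K (TorusPolymer.translate a X) ψ = K X (fieldShift (-a) ψ) := by
  have := hK a ha X (fieldShift (-a) ψ)
  rwa [fieldShift_fieldShift, neg_add_cancel, fieldShift_zero] at this

/-- **Every block term is a `Π₂`-remainder**: for translation-invariant `K` and `B = B₀ + v`
(`v ∈ (L^kℤ)^d`), `G(B) = R K(B) − Π₂^{(c₀+v, B)} R K(B)`, i.e. `blockTerm D K B = Pi2Rem (c₀+v) B (RK(B))`.
[cite: AdamsBuchholzKoteckyMuller2019, Theorem 6.8 (6.58), Lemma 6.4 (1)] -/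
theorem blockTerm_eq_Pi2Rem (D : StepData d M) (hC : (Matrix.circulant D.𝒞).PosSemidef)
    {K : Finset (Fin d → ZMod M) → ((Fin d → ZMod M) → ℝ) → ℂ} (hK : TransInv D.s K)
    {v : Fin d → ZMod M} (hv : TorusPolymer.IsLatticeVec D.s v) :
    blockTerm D K (TorusPolymer.translate v D.B₀) =
      Pi2Rem (D.c₀ + v) (TorusPolymer.translate v D.B₀) (fluct D.𝒞 (K (TorusPolymer.translate v D.B₀))) := by
  have hKB : K (TorusPolymer.translate v D.B₀) = fun ψ => K D.B₀ (fieldShift (-v) ψ) :=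
    funext fun ψ => apply_eq_of_transInv hK hv D.B₀ ψ
  have hfl : fluct D.𝒞 (K (TorusPolymer.translate v D.B₀)) = fun φ => fluct D.𝒞 (K D.B₀) (fieldShift (-v) φ) := by
    rw [hKB]; funext φ; exact fluct_translate hC (K D.B₀) v φ
  funext φ
  rw [blockTerm, Pi2Rem, hfl, Pi2_translate, opB, Pi.sub_apply]
  rw [show -Pi2 D.c₀ D.B₀ (fluct D.𝒞 (K D.B₀)) = (-1 : ℂ) • Pi2 D.c₀ D.B₀ (fluct D.𝒞 (K D.B₀)) from
    (neg_one_smul ℂ _).symm, eval_smul]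
  ring

/-- Every `k`-block is a lattice translate of the reference block (odd torus `M = s·t`):
`B_y = B_{x₀} + (c(B_y) − c(B_{x₀}))`. [cite: AdamsBuchholzKoteckyMuller2019, Ch. 6.2] -/
theorem exists_blockOf_eq_translate {s t : ℕ} (hM : M = s * t) (hs : Odd s) (ht : Odd t)
    (x₀ y : Fin d → ZMod M) :
    ∃ v : Fin d → ZMod M, TorusPolymer.IsLatticeVec s v ∧
      blockOf s y = TorusPolymer.translate v (blockOf s x₀) := by
  refine ⟨TorusPolymer.blockCenter s y - TorusPolymer.blockCenter s x₀,
    TorusPolymer.isLatticeVec_blockCenter_sub s y x₀, ?_⟩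
  rw [← TorusPolymer.blockOf_add hM hs ht (TorusPolymer.isLatticeVec_blockCenter_sub s y x₀) x₀]
  -- `x₀ + (c_y − c_{x₀})` lies in the block of `y`
  refine (blockOf_eq_of_mem ?_).symm
  apply TorusPolymer.mem_blockOf_of_supNorm_sub_le hM hs ht
  have : x₀ + (TorusPolymer.blockCenter s y - TorusPolymer.blockCenter s x₀) - TorusPolymer.blockCenter s y
      = x₀ - TorusPolymer.blockCenter s x₀ := by abel
  rw [this]
  exact TorusPolymer.supNorm_sub_blockCenter_le hM hs ht x₀

/-! ## The summation step of Lemma 10.4 and the assembly of Lemma 10.1 -/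

section Bounds

variable {V : Type*} [NormedAddCommGroup V] [NormedSpace ℝ V]

/-- **Lemma 10.4, summation step ((10.13))**: if every block term obeys
`|G(B)|_{T_φ} ≤ C c_G A^{−1} w(φ)` at the gauge and weight of `U` (Lemma 10.3 + (w9)), then
`|G(U)|_{T_φ} ≤ C (L^d c_G) A^{−|U|_{k+1}} w(φ)`. [cite: AdamsBuchholzKoteckyMuller2019, Lemma 10.4 (10.13)] -/
theorem tayNormLE_blockPart (D : StepData d M) {t : ℕ} (hM : M = D.L * D.s * t) (hs : Odd D.s)
    (hL : Odd D.L) (ht : Odd t) (T : ((Fin d → ZMod M) → ℝ) →ₗ[ℝ] V)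
    {w : ((Fin d → ZMod M) → ℝ) → ℝ} (hw : ∀ φ, 0 ≤ w φ) {r₀ : ℕ}
    {K : Finset (Fin d → ZMod M) → ((Fin d → ZMod M) → ℝ) → ℂ} {A C cG : ℝ} (hA : 1 ≤ A)
    (hC : 0 ≤ C) (hcG : 0 ≤ cG) {U : Finset (Fin d → ZMod M)}
    (hGd : ∀ B ∈ blockPartIndex D U, ContDiff ℝ r₀ (blockTerm D K B))
    (hG : ∀ B ∈ blockPartIndex D U, TayNormLE T r₀ w (blockTerm D K B) (C * cG * A⁻¹)) :
    TayNormLE T r₀ w (blockPart D K U) (C * (D.L ^ d * cG) * (A ^ (blocks (D.L * D.s) U).card)⁻¹) := by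
  have hA0 : 0 < A := by linarith
  have h1 := TayNormLE.sum (blockPartIndex D U) (F := fun B => blockTerm D K B) hG hGd
  obtain ⟨hcard, hone⟩ := card_blockPartIndex_le D hM hs hL ht U
  have hle : ∑ B ∈ blockPartIndex D U, C * cG * A⁻¹
      ≤ C * (D.L ^ d * cG) * (A ^ (blocks (D.L * D.s) U).card)⁻¹ := by
    by_cases he : blockPartIndex D U = ∅
    · rw [he, sum_empty]; positivity
    rw [hone he, pow_one, sum_const, nsmul_eq_mul]
    have : ((blockPartIndex D U).card : ℝ) ≤ D.L ^ d := by exact_mod_cast hcard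
    calc ((blockPartIndex D U).card : ℝ) * (C * cG * A⁻¹) ≤ (D.L : ℝ) ^ d * (C * cG * A⁻¹) :=
          mul_le_mul_of_nonneg_right this (by positivity)
      _ = C * (D.L ^ d * cG) * A⁻¹ := by ring
  intro φ
  have := (h1.mono hle hw) φ
  unfold blockPart
  exact this

/-- **Lemma 10.1 (assembly): `‖C^{(q)}K‖_{k+1}^{(A)} ≤ (L^d c_G + ε(A)) ‖K‖_k^{(A)}`.**  Per-block
bounds `|G(B)|_{T_φ} ≤ C c_G A^{−1} w(φ)` (Lemmas 10.3–10.4) and per-polymer bounds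
`|R K(X)|_{T_φ} ≤ C κ^{|X|_k} A^{−|X|_k} w(φ)` (Lemma 8.4 + 8.1 + (w6)) with the closure gain give
`|(C^{(q)}K)(U)|_{T_φ} ≤ C (L^d c_G + ε(A)) A^{−|U|_{k+1}} w(φ)` for every non-empty `(k+1)`-polymer `U`.
[cite: AdamsBuchholzKoteckyMuller2019, Lemma 10.1] -/
theorem tayNormLE_opC (D : StepData d M) {t : ℕ} (hM : M = D.L * D.s * t) (hs : Odd D.s)
    (hL : Odd D.L) (ht : Odd t) (T : ((Fin d → ZMod M) → ℝ) →ₗ[ℝ] V)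
    {w : ((Fin d → ZMod M) → ℝ) → ℝ} (hw : ∀ φ, 0 ≤ w φ) {r₀ : ℕ}
    {K : Finset (Fin d → ZMod M) → ((Fin d → ZMod M) → ℝ) → ℂ} {A κ η C cG : ℝ} (hA : 1 ≤ A)
    (hκ : 0 ≤ κ) (hκA : κ ≤ A) (hη : 0 < η) (hC : 0 ≤ C) (hcG : 0 ≤ cG)
    (hsmall : (2 : ℝ) ^ (D.L ^ d) * (κ * A ^ (-(1 - η⁻¹) : ℝ)) ≤ 1)
    (hgain : ∀ X : Finset (Fin d → ZMod M), IsPolymer D.s X → IsConn X → 2 ^ d < (blocks D.s X).card →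
      η * ((blocks (D.L * D.s) (closure (D.L * D.s) X)).card : ℝ) ≤ (blocks D.s X).card)
    {U : Finset (Fin d → ZMod M)} (hU : IsPolymer (D.L * D.s) U) (hUne : U.Nonempty)
    (hGd : ∀ B ∈ blockPartIndex D U, ContDiff ℝ r₀ (blockTerm D K B))
    (hG : ∀ B ∈ blockPartIndex D U, TayNormLE T r₀ w (blockTerm D K B) (C * cG * A⁻¹))
    (hRd : ∀ X ∈ largePartIndex D.s D.L U, ContDiff ℝ r₀ (fluct D.𝒞 (K X)))
    (hR : ∀ X ∈ largePartIndex D.s D.L U,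
      TayNormLE T r₀ w (fluct D.𝒞 (K X)) (C * (κ ^ (blocks D.s X).card * (A ^ (blocks D.s X).card)⁻¹))) :
    TayNormLE T r₀ w (opC D K U)
      (C * (D.L ^ d * cG + largePartEps d D.L A κ η) * (A ^ (blocks (D.L * D.s) U).card)⁻¹) := by
  have h1 := tayNormLE_blockPart D hM hs hL ht T hw hA hC hcG hGd hG
  have h2 := tayNormLE_largePart hM hs hL ht T hw (R := fluct D.𝒞) (K := K) hA hκ hκA hη hC hsmall
    hgain hU hUne hRd hR
  have hd1 : ContDiff ℝ r₀ (blockPart D K U) := by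
    have : blockPart D K U = fun φ => ∑ B ∈ blockPartIndex D U, blockTerm D K B φ := rfl
    rw [this]; exact ContDiff.sum fun B hB => hGd B hB
  have hd2 : ContDiff ℝ r₀ (largePart D.s D.L (fluct D.𝒞) K U) := by
    have : largePart D.s D.L (fluct D.𝒞) K U = fun φ => ∑ X ∈ largePartIndex D.s D.L U, fluct D.𝒞 (K X) φ := rfl
    rw [this]; exact ContDiff.sum fun X hX => hRd X hX
  have h := h1.add h2 hd1 hd2
  intro φ
  have := h φ
  have e : opC D K U = blockPart D K U + largePart D.s D.L (fluct D.𝒞) K U := rfl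
  rw [e]
  refine this.trans (le_of_eq ?_)
  ring

end Bounds

end Literature.MathematicalPhysics.StatisticalMechanics.GradientRG

end
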